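import Mathlib.Algebra.MvPolynomial.Equiv
import Mathlib.Algebra.MvPolynomial.CommRing
import Mathlib.RingTheory.MvPolynomial.Basic
import Mathlib.LinearAlgebra.Matrix.Determinant.Basic
import Literature.RingTheory.CompleteIntersection.TransitionDeterminant
import Literature.Computability.AlgebraicComplexity.CircuitCoeffIdeal
import HarnessLib

/-!
# The Bezoutian of `m` polynomials in `m` variables and interpolation at an isolated zero

Topic `Literature/RingTheory/CompleteIntersection`. Let `k ⊆ F` be fields of characteristic `0`,
`H₁, …, H_m ∈ k[x₁, …, x_m]` with `deg Hᵢ ≤ eᵢ` (`eᵢ ≥ 1`) and `P ∈ Fᵐ` a common zero with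
algebraic coordinates. The classical interpolation theorem of Jacobi and Kronecker (simple zeros)
and its extension to multiple ISOLATED zeros through the local duality of complete intersections
(Scheja–Storch, *Über Spurfunktionen bei vollständigen Durchschnitten*, J. reine angew. Math.
278/279 (1975); Tate's appendix to Mazur–Roberts; de Smit–Rubin–Schoof, *Criteria for complete
intersections*, Prop. 2.1, Cor. 2.2 — "Tate–Wiebe") say that such a zero, if isolated, imposes
independent conditions on the polynomials of degree `∑ (eᵢ − 1)`. We prove it in the following
form (`exists_totalDegree_le_aeval_eq_of_isolated`): if `(H)` is isolated at the closed point of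
`P` — some `u ∈ k[x]` with `u(P) ≠ 0` has `u · μᵢ(xᵢ)ᴺ ∈ (H)` for all `i`, `μᵢ` the minimal
polynomial of `Pᵢ` — then for every `ν ≥ e₁ + ⋯ + e_m − m` evaluation at `P` maps the polynomials
of degree `≤ ν` ONTO the field `k[P] = k(P)`. This is the affine, one-closed-point core of the
regularity of isolated points of Chardin–Philippon (*Régularité et interpolation*, J. Algebraic
Geom. 8 (1999)), used in `Literature/RingTheory/GradedAlgebra/IsolatedComponentRegularity*.lean`.

## The proof (Bezoutian and local duality)

* `exists_dividedDiff`, `exists_bezoutian` — divided differences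
  `Hᵢ(x) − Hᵢ(y) = ∑ⱼ (xⱼ − yⱼ) pᵢⱼ(x, y)` with `deg pᵢⱼ ≤ eᵢ − 1`; the **Bezoutian**
  `Δ = det (pᵢⱼ) ∈ k[x, y]` has `deg Δ ≤ ∑ (eᵢ − 1)` and `(xⱼ − yⱼ) Δ ∈ (Hᵢ(x) − Hᵢ(y))ᵢ`
  (Cramer).
* The pairing `ψ ⊗ ev_P` (`ψ` a `k`-linear functional on `k[x]`): realised as `extF[ψ] ∘ θ_P`,
  where `θ_P : k[x, y] → F[x]` substitutes `P` for `y` and `extF[ψ]` is the `F`-linear extension of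
  `ψ` (local notations). `extF_map_mul`: `extF[ψ](q Q) = extF[ψ(q ·)](Q)`; hence the pairing
  kills `∑ cᵢ (Hᵢ(x) − Hᵢ(y))` when `ψ ⊥ (H)` and `H(P) = 0`
  (`extF_theta_sum_mul_sub_eq_zero`), and **`Pⱼ · (ψ ⊗ ev_P)(Δ) = (ψ(xⱼ ·) ⊗ ev_P)(Δ)`**
  (`mul_extF_theta_eq`): the values `(ψ ⊗ ev_P)(Δ)`, `ψ ⊥ (H)`, form a `k[P]`-module; each is
  the value at `P` of a polynomial of degree `≤ deg Δ`
  (`exists_totalDegree_le_aeval_eq_extF_theta`, `f = ∑_α ψ(x^α) Δ_α(y)`).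
* **Non-vanishing** (`exists_dual_extF_theta_det_ne_zero`): if all these values vanished then
  `Δ(x, P) ∈ (H) F[x]` (`mem_map_of_forall_dual`: expand coefficients in a `k`-basis of `F` and
  separate `k[x]/(H)` by functionals); translating `P` to the origin (`τ_P`), `Δ(x, P)` is the
  transition determinant expressing the `Hᵢ` in the `xⱼ − Pⱼ`, and the isolation hypothesis
  (through `μᵢ = (t − Pᵢ) ρᵢ`, `ρᵢ(Pᵢ) ≠ 0`, separability, `exists_minpoly_map_eq_mul`) is the
  hypothesis of Wiebe's lemma `Literature.RingTheory.CompleteIntersection.det_notMem_span_of_mem`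
  — contradiction.
* `exists_totalDegree_le_aeval_eq_of_isolated` — a non-zero `k[P]`-submodule of the field `k[P]`
  is everything.

Everything is proved; there are no definitions (the three local notations `extF[ψ]`, `θ[P]`,
`τ[P]` abbreviate Mathlib terms) and no named facts.

## References

* [DeSmitRubinSchoof1997] B. de Smit, K. Rubin, R. Schoof, *Criteria for complete intersections*,
  in: Modular Forms and Fermat's Last Theorem, Springer 1997, Prop. 2.1 (Tate), Cor. 2.2.
* G. Scheja, U. Storch, *Über Spurfunktionen bei vollständigen Durchschnitten*, J. reine angew.
  Math. 278/279 (1975) 174–190 (Bezoutian `Δ`, local duality, §§1–3).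
* [ChardinPhilippon1999] M. Chardin, P. Philippon, *Régularité et interpolation*, J. Algebraic
  Geom. 8 (1999) 471–481 (the application).
-/

noncomputable section

open MvPolynomial Matrix

namespace Literature.RingTheory.CompleteIntersection

/-! ### Divided differences and the Bezoutian -/

section Bezoutian

variable {k : Type*} [CommRing k] {m : ℕ}

/-- **Divided differences of a monomial**: `x^α − y^α = ∑ⱼ (xⱼ − yⱼ) pⱼ(x, y)` with
`deg pⱼ ≤ |α| − 1` (telescoping one variable at a time). [folklore] -/
theorem exists_dividedDiff_monomial (n : ℕ) : ∀ α : Fin m →₀ ℕ, α.degree = n →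
    ∃ p : Fin m → MvPolynomial (Fin m ⊕ Fin m) k,
      rename Sum.inl (monomial α (1 : k)) - rename Sum.inr (monomial α 1) =
          ∑ j, (X (Sum.inl j) - X (Sum.inr j)) * p j ∧
        ∀ j, (p j).totalDegree + 1 ≤ n ∨ p j = 0 := by
  classical
  induction n with
  | zero =>
    intro α hα
    rw [Finsupp.degree_eq_zero_iff] at hα
    subst hα
    exact ⟨0, by simp, fun j => Or.inr rfl⟩
  | succ n ih =>
    intro α hα
    have hα0 : α ≠ 0 := fun h => by rw [h, map_zero] at hα; exact Nat.succ_ne_zero n hα.symm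
    obtain ⟨i, hi⟩ := Finsupp.ne_iff.mp hα0
    rw [Finsupp.coe_zero, Pi.zero_apply] at hi
    set β : Fin m →₀ ℕ := α - Finsupp.single i 1 with hβ
    have hαβ : α = β + Finsupp.single i 1 := (Finsupp.sub_add_single_one_cancel hi).symm
    have hβn : β.degree = n := by
      have h := congrArg Finsupp.degree hαβ
      rw [map_add, Finsupp.degree_single, hα] at h
      omega
    obtain ⟨p, hp, hpdeg⟩ := ih β hβn
    refine ⟨fun j => p j * X (Sum.inl i) + if j = i then rename Sum.inr (monomial β (1 : k)) else 0,
      ?_, fun j => Or.inl ?_⟩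
    · -- `x^α − y^α = (x^β − y^β) xᵢ + y^β (xᵢ − yᵢ)`
      have e1 : (monomial α (1 : k)) = monomial β 1 * X i := by
        rw [hαβ, X, monomial_mul, mul_one]
      rw [e1, map_mul, map_mul, rename_X, rename_X]
      have e2 : rename Sum.inl (monomial β (1 : k)) * X (Sum.inl i) -
          rename Sum.inr (monomial β (1 : k)) * X (Sum.inr i) =
          (rename Sum.inl (monomial β (1 : k)) - rename Sum.inr (monomial β 1)) * X (Sum.inl i) +
            (X (Sum.inl i) - X (Sum.inr i)) * rename Sum.inr (monomial β (1 : k)) := by ring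
      rw [e2, hp, Finset.sum_mul]
      simp only [mul_add, mul_ite, mul_zero, Finset.sum_add_distrib, Finset.sum_ite_eq',
        Finset.mem_univ, if_true]
      refine congrArg₂ (· + ·) (Finset.sum_congr rfl fun j _ => by ring) rfl
    · -- degrees
      refine Nat.succ_le_succ ((totalDegree_add _ _).trans (max_le ?_ ?_))
      · rcases hpdeg j with h | h
        · refine (totalDegree_mul _ _).trans ?_
          have : (X (Sum.inl i) : MvPolynomial (Fin m ⊕ Fin m) k).totalDegree ≤ 1 := by
            rw [X]; exact (totalDegree_monomial_le _ _).trans (by simp)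
          omega
        · rw [h, zero_mul, totalDegree_zero]; exact Nat.zero_le _
      · split_ifs
        · refine (totalDegree_rename_le _ _).trans ?_
          refine (totalDegree_monomial_le _ _).trans ?_
          rw [← hβn]; rfl
        · rw [totalDegree_zero]; exact Nat.zero_le _

/-- **Divided differences**: for `H ∈ k[x₁, …, x_m]` of total degree `≤ e` (`e ≥ 1`) there are
`p₁, …, p_m ∈ k[x, y]` of total degree `≤ e − 1` with `H(x) − H(y) = ∑ⱼ (xⱼ − yⱼ) pⱼ(x, y)`.
[folklore] -/
theorem exists_dividedDiff (H : MvPolynomial (Fin m) k) {e : ℕ} (he : 1 ≤ e)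
    (hH : H.totalDegree ≤ e) :
    ∃ p : Fin m → MvPolynomial (Fin m ⊕ Fin m) k,
      rename Sum.inl H - rename Sum.inr H = ∑ j, (X (Sum.inl j) - X (Sum.inr j)) * p j ∧
        ∀ j, (p j).totalDegree ≤ e - 1 := by
  classical
  choose p hp hpdeg using fun α : Fin m →₀ ℕ => exists_dividedDiff_monomial (k := k) (α.degree) α rfl
  refine ⟨fun j => ∑ α ∈ H.support, C (coeff α H) * p α j, ?_, fun j => ?_⟩
  · conv_lhs => rw [H.as_sum]
    simp only [map_sum, ← Finset.sum_sub_distrib, Finset.mul_sum]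
    rw [Finset.sum_comm]
    refine Finset.sum_congr rfl fun α _ => ?_
    have e1 : (monomial α (coeff α H)) = C (coeff α H) * monomial α 1 := by
      rw [C_mul_monomial, mul_one]
    rw [e1, map_mul, map_mul, rename_C, rename_C, ← mul_sub, hp α, Finset.mul_sum]
    exact Finset.sum_congr rfl fun j _ => by ring
  · refine totalDegree_finsetSum_le fun α hα => (totalDegree_mul _ _).trans ?_
    rw [totalDegree_C, zero_add]
    rcases hpdeg α j with h | h
    · have hαe : α.degree ≤ e := by
        have := le_totalDegree hα
        rw [Finsupp.degree_apply]
        exact le_trans this hH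
      omega
    · rw [h, totalDegree_zero]; exact Nat.zero_le _

/-- **The Bezoutian matrix** of `H₁, …, H_m ∈ k[x₁, …, x_m]` with `deg Hᵢ ≤ eᵢ`, `eᵢ ≥ 1`: polynomials
`pᵢⱼ(x, y)` of degree `≤ eᵢ − 1` with `Hᵢ(x) − Hᵢ(y) = ∑ⱼ (xⱼ − yⱼ) pᵢⱼ(x, y)`; its determinant,
the **Bezoutian** `Δ(x, y)`, has degree `≤ ∑ (eᵢ − 1)` and satisfies `(xⱼ − yⱼ) Δ ∈ (Hᵢ(x) − Hᵢ(y))`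
for every `j` (Cramer). [folklore] -/
theorem exists_bezoutian (H : Fin m → MvPolynomial (Fin m) k) (e : Fin m → ℕ) (he : ∀ i, 1 ≤ e i)
    (hH : ∀ i, (H i).totalDegree ≤ e i) :
    ∃ (p : Matrix (Fin m) (Fin m) (MvPolynomial (Fin m ⊕ Fin m) k)),
      (∀ i, rename Sum.inl (H i) - rename Sum.inr (H i) =
          ∑ j, (X (Sum.inl j) - X (Sum.inr j)) * p i j) ∧
      p.det.totalDegree + m ≤ ∑ i, e i ∧
      ∀ j, (X (Sum.inl j) - X (Sum.inr j)) * p.det ∈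
        Ideal.span (Set.range fun i => rename Sum.inl (H i) - rename Sum.inr (H i)) := by
  classical
  choose p hp hpdeg using fun i => exists_dividedDiff (H i) (he i) (hH i)
  refine ⟨Matrix.of p, fun i => by simpa only [Matrix.of_apply] using hp i, ?_, fun j => ?_⟩
  · -- degree of the determinant
    have hdet : (Matrix.of p).det.totalDegree ≤ ∑ i, (e i - 1) := by
      rw [det_apply']
      refine totalDegree_finsetSum_le fun σ _ => (totalDegree_mul _ _).trans ?_
      have h0 : ((Equiv.Perm.sign σ : ℤ) : MvPolynomial (Fin m ⊕ Fin m) k).totalDegree = 0 := by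
        rw [← map_intCast (C : k →+* MvPolynomial (Fin m ⊕ Fin m) k), totalDegree_C]
      rw [h0, zero_add]
      refine (totalDegree_finsetProd _ _).trans ?_
      calc ∑ i, (Matrix.of p (σ i) i).totalDegree ≤ ∑ i, (e (σ i) - 1) :=
            Finset.sum_le_sum fun i _ => by rw [Matrix.of_apply]; exact hpdeg (σ i) i
        _ = ∑ i, (e i - 1) := Equiv.sum_comp σ (fun i => e i - 1)
    have hsum : ∑ i, (e i - 1) + m = ∑ i, e i := by
      have : ∑ i : Fin m, (e i - 1) + ∑ _i : Fin m, 1 = ∑ i, e i := by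
        rw [← Finset.sum_add_distrib]
        exact Finset.sum_congr rfl fun i _ => Nat.sub_add_cancel (he i)
      simpa using this
    omega
  · -- Cramer
    have h := det_mul_mem_span_of_mulVec_eq (Matrix.of p)
      (fun j => (X (Sum.inl j) : MvPolynomial (Fin m ⊕ Fin m) k) - X (Sum.inr j))
      (fun i => rename Sum.inl (H i) - rename Sum.inr (H i))
      (fun i => by rw [hp i]; exact Finset.sum_congr rfl fun j _ => by rw [Matrix.of_apply, mul_comm]) j
    rwa [mul_comm] at h

end Bezoutian

/-! ### The pairing `ψ ⊗ ev_P` and the extension of scalars of a functional -/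

section Pairing

variable {k : Type*} [Field k] {F : Type*} [Field F] [Algebra k F] {m : ℕ}

/-- `extF[ψ]`: the `F`-linear extension to `F[x₁, …, x_m]` of a `k`-linear functional `ψ` on
`k[x₁, …, x_m]` (`x^α ↦ ψ(x^α)`). Local notation only. -/
local notation3 "extF[" ψ "]" => (MvPolynomial.basisMonomials (Fin m) F).constr F
    (fun α : Fin m →₀ ℕ => algebraMap k F ((ψ : MvPolynomial (Fin m) k →ₗ[k] k) (monomial α 1)))

/-- `θ_P`: substitute the point `P` for the second block of variables, `k[x, y] → F[x]`.
Local notation only. -/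
local notation3 "θ[" P "]" => (MvPolynomial.aeval
    (Sum.elim (fun i : Fin m => (X i : MvPolynomial (Fin m) F)) fun j : Fin m => C ((P : Fin m → F) j)) :
      MvPolynomial (Fin m ⊕ Fin m) k →ₐ[k] MvPolynomial (Fin m) F)

/-- `extF[ψ]` on monomials. [folklore] -/
theorem extF_monomial (ψ : MvPolynomial (Fin m) k →ₗ[k] k) (α : Fin m →₀ ℕ) (c : F) :
    extF[ψ] (monomial α c) = c * algebraMap k F (ψ (monomial α 1)) := by
  have h1 : (monomial α c : MvPolynomial (Fin m) F) =
      c • (MvPolynomial.basisMonomials (Fin m) F) α := by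
    rw [coe_basisMonomials, smul_monomial, smul_eq_mul, mul_one]
  rw [h1, map_smul, Module.Basis.constr_basis, smul_eq_mul]

/-- Two functionals proportional on monomials have proportional extensions. [folklore] -/
theorem extF_eq_mul_of_forall (ψ ψ' : MvPolynomial (Fin m) k →ₗ[k] k) (c : k)
    (h : ∀ α, ψ' (monomial α 1) = c * ψ (monomial α 1)) (Q : MvPolynomial (Fin m) F) :
    extF[ψ'] Q = algebraMap k F c * extF[ψ] Q := by
  induction Q using MvPolynomial.induction_on' with
  | monomial α a => rw [extF_monomial, extF_monomial, h, map_mul]; ring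
  | add p q hp hq => rw [map_add, map_add, hp, hq, mul_add]

/-- Additivity of the extension in the functional. [folklore] -/
theorem extF_eq_add_of_forall (ψ ψ' ψ'' : MvPolynomial (Fin m) k →ₗ[k] k)
    (h : ∀ α, ψ'' (monomial α 1) = ψ (monomial α 1) + ψ' (monomial α 1))
    (Q : MvPolynomial (Fin m) F) : extF[ψ''] Q = extF[ψ] Q + extF[ψ'] Q := by
  induction Q using MvPolynomial.induction_on' with
  | monomial α a => rw [extF_monomial, extF_monomial, extF_monomial, h, map_add]; ring
  | add p q hp hq => rw [map_add, map_add, map_add, hp, hq]; ring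

/-- The extension of `ψ` evaluated on (the image of) a polynomial with coefficients in `k` is
`ψ` itself. [folklore] -/
theorem extF_map (ψ : MvPolynomial (Fin m) k →ₗ[k] k) (q : MvPolynomial (Fin m) k) :
    extF[ψ] (map (algebraMap k F) q) = algebraMap k F (ψ q) := by
  induction q using MvPolynomial.induction_on' with
  | monomial α a =>
    rw [map_monomial, extF_monomial, ← map_mul]
    congr 1
    have : (monomial α a : MvPolynomial (Fin m) k) = a • monomial α 1 := by
      rw [smul_monomial, smul_eq_mul, mul_one]
    rw [this, map_smul, smul_eq_mul]
  | add p q hp hq => rw [map_add, map_add, hp, hq, map_add, map_add]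

/-- **Multiplication by `xⱼ` is adjoint to precomposition**: `extF[ψ](xⱼ Q) = extF[ψ(xⱼ ·)](Q)`.
[folklore] -/
theorem extF_X_mul (ψ : MvPolynomial (Fin m) k →ₗ[k] k) (j : Fin m) (Q : MvPolynomial (Fin m) F) :
    extF[ψ] (X j * Q) = extF[ψ ∘ₗ LinearMap.mul k (MvPolynomial (Fin m) k) (X j)] Q := by
  induction Q using MvPolynomial.induction_on' with
  | monomial α a =>
    have e1 : (X j : MvPolynomial (Fin m) F) * monomial α a = monomial (Finsupp.single j 1 + α) a := by
      rw [X, monomial_mul, one_mul]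
    rw [e1, extF_monomial, extF_monomial]
    congr 2
    rw [LinearMap.comp_apply, LinearMap.mul_apply', X, monomial_mul, one_mul]
  | add p q hp hq => rw [mul_add, map_add, map_add, hp, hq]

/-- `extF[ψ](q Q) = extF[ψ(q ·)](Q)` for `q ∈ k[x]`. [folklore] -/
theorem extF_map_mul (ψ : MvPolynomial (Fin m) k →ₗ[k] k) (q : MvPolynomial (Fin m) k)
    (Q : MvPolynomial (Fin m) F) :
    extF[ψ] (map (algebraMap k F) q * Q) = extF[ψ ∘ₗ LinearMap.mul k (MvPolynomial (Fin m) k) q] Q := by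
  induction q using MvPolynomial.induction_on generalizing ψ Q with
  | C a =>
    rw [map_C, C_mul', map_smul, smul_eq_mul]
    refine (extF_eq_mul_of_forall ψ _ a (fun α => ?_) Q).symm
    rw [LinearMap.comp_apply, LinearMap.mul_apply', C_mul', map_smul, smul_eq_mul]
  | add p q hp hq =>
    rw [map_add, add_mul, map_add, hp, hq]
    refine (extF_eq_add_of_forall _ _ _ (fun α => ?_) Q).symm
    simp only [LinearMap.comp_apply, LinearMap.add_apply, LinearMap.mul_apply', map_add]
  | mul_X p j hp =>
    rw [show MvPolynomial.map (algebraMap k F) (p * X j) = MvPolynomial.map (algebraMap k F) p * X j by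
      rw [map_mul, map_X], mul_assoc, hp, extF_X_mul]
    have : (ψ ∘ₗ LinearMap.mul k (MvPolynomial (Fin m) k) p) ∘ₗ
        LinearMap.mul k (MvPolynomial (Fin m) k) (X j) =
        ψ ∘ₗ LinearMap.mul k (MvPolynomial (Fin m) k) (p * X j) := by
      ext x
      simp only [LinearMap.comp_apply, LinearMap.mul_apply', mul_assoc]
    rw [this]

/-- `θ_P` on the first block of variables: extension of scalars. [folklore] -/
theorem theta_rename_inl (P : Fin m → F) (q : MvPolynomial (Fin m) k) :
    θ[P] (rename Sum.inl q) = map (algebraMap k F) q := by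
  induction q using MvPolynomial.induction_on with
  | C a => rw [rename_C, algHom_C, map_C, MvPolynomial.algebraMap_apply]
  | add p q hp hq => rw [map_add, map_add, hp, hq, map_add]
  | mul_X p i hp => rw [map_mul, rename_X, map_mul, hp, aeval_X, Sum.elim_inl, map_mul, map_X]

/-- `θ_P` on the second block of variables: evaluation at `P`. [folklore] -/
theorem theta_rename_inr (P : Fin m → F) (q : MvPolynomial (Fin m) k) :
    θ[P] (rename Sum.inr q) = C (aeval P q) := by
  induction q using MvPolynomial.induction_on with
  | C a => rw [rename_C, algHom_C, algHom_C, MvPolynomial.algebraMap_apply]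
  | add p q hp hq => rw [map_add, map_add, hp, hq, map_add, map_add]
  | mul_X p i hp => rw [map_mul, rename_X, map_mul, hp, aeval_X, Sum.elim_inr, map_mul, aeval_X,
      map_mul]

variable {H : Fin m → MvPolynomial (Fin m) k} {P : Fin m → F}

/-- **The pairing kills the diagonal relations**: if `ψ` vanishes on the ideal `(H)` and `P` is a
common zero of the `Hᵢ`, then `(ψ ⊗ ev_P)(∑ cᵢ (Hᵢ(x) − Hᵢ(y))) = 0`. [folklore] -/
theorem extF_theta_sum_mul_sub_eq_zero (ψ : MvPolynomial (Fin m) k →ₗ[k] k)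
    (hψ : ∀ r ∈ Ideal.span (Set.range H), ψ r = 0) (hP : ∀ i, aeval P (H i) = 0)
    (c : Fin m → MvPolynomial (Fin m ⊕ Fin m) k) :
    extF[ψ] (θ[P] (∑ i, c i * (rename Sum.inl (H i) - rename Sum.inr (H i)))) = 0 := by
  rw [map_sum, map_sum]
  refine Finset.sum_eq_zero fun i _ => ?_
  rw [map_mul, map_sub, theta_rename_inl, theta_rename_inr, hP i, C_0, sub_zero, mul_comm,
    extF_map_mul]
  have h0 : ∀ α, (ψ ∘ₗ LinearMap.mul k (MvPolynomial (Fin m) k) (H i)) (monomial α 1) =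
      0 * (0 : MvPolynomial (Fin m) k →ₗ[k] k) (monomial α 1) := by
    intro α
    rw [zero_mul, LinearMap.comp_apply, LinearMap.mul_apply']
    exact hψ _ (Ideal.mul_mem_right _ _ (Ideal.subset_span ⟨i, rfl⟩))
  rw [extF_eq_mul_of_forall 0 _ 0 h0, map_zero, zero_mul]

/-- **The module identity** `Pⱼ · (ψ ⊗ ev_P)(Δ) = (ψ(xⱼ ·) ⊗ ev_P)(Δ)` for any `Δ` with
`(xⱼ − yⱼ) Δ ∈ (Hᵢ(x) − Hᵢ(y))` (e.g. the Bezoutian), `ψ ⊥ (H)`, `H(P) = 0`. [folklore] -/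
theorem mul_extF_theta_eq (ψ : MvPolynomial (Fin m) k →ₗ[k] k)
    (hψ : ∀ r ∈ Ideal.span (Set.range H), ψ r = 0) (hP : ∀ i, aeval P (H i) = 0)
    {Δ : MvPolynomial (Fin m ⊕ Fin m) k} {j : Fin m}
    (hΔ : (X (Sum.inl j) - X (Sum.inr j)) * Δ ∈
      Ideal.span (Set.range fun i => rename Sum.inl (H i) - rename Sum.inr (H i))) :
    P j * extF[ψ] (θ[P] Δ) =
      extF[ψ ∘ₗ LinearMap.mul k (MvPolynomial (Fin m) k) (X j)] (θ[P] Δ) := by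
  obtain ⟨c, hc⟩ := Ideal.mem_span_range_iff_exists_fun.mp hΔ
  have h0 := extF_theta_sum_mul_sub_eq_zero ψ hψ hP c
  rw [hc, map_mul, map_sub, aeval_X, aeval_X, Sum.elim_inl, Sum.elim_inr, sub_mul, map_sub,
    extF_X_mul, C_mul', map_smul, smul_eq_mul, sub_eq_zero] at h0
  exact h0.symm

/-- **The pairing takes values in the image of polynomials of degree `≤ deg Δ`**: there is
`f ∈ k[y]` with `deg f ≤ deg Δ` and `f(P) = (ψ ⊗ ev_P)(Δ)` (`f = ∑_α ψ(x^α) Δ_α(y)` for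
`Δ = ∑_α Δ_α(y) x^α`). [folklore] -/
theorem exists_totalDegree_le_aeval_eq_extF_theta (ψ : MvPolynomial (Fin m) k →ₗ[k] k)
    (Δ : MvPolynomial (Fin m ⊕ Fin m) k) :
    ∃ f : MvPolynomial (Fin m) k, f.totalDegree ≤ Δ.totalDegree ∧ aeval P f = extF[ψ] (θ[P] Δ) := by
  classical
  set E := sumAlgEquiv k (Fin m) (Fin m) Δ with hE
  refine ⟨∑ α ∈ E.support, ψ (monomial α 1) • coeff α E, ?_, ?_⟩
  · refine totalDegree_finsetSum_le fun α _ => (totalDegree_smul_le _ _).trans ?_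
    exact Literature.Computability.AlgebraicComplexity.totalDegree_coeff_sumAlgEquiv_le Δ α
  · have hcoeff : ∀ α, aeval P (coeff α E) = coeff α (θ[P] Δ) := fun α =>
      Literature.Computability.AlgebraicComplexity.aeval_coeff_sumAlgEquiv P α Δ
    rw [map_sum]
    conv_rhs => rw [(θ[P] Δ).as_sum, map_sum]
    have hsub : (θ[P] Δ).support ⊆ E.support := by
      intro α hα
      rw [mem_support_iff] at hα ⊢
      intro h; apply hα; rw [← hcoeff, h, map_zero]
    have h2 : ∀ α ∈ E.support, α ∉ (θ[P] Δ).support →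
        extF[ψ] (monomial α (coeff α (θ[P] Δ))) = 0 := by
      intro α _ hα
      rw [notMem_support_iff] at hα
      rw [hα, monomial_zero, map_zero]
    rw [Finset.sum_subset hsub h2]
    refine Finset.sum_congr rfl fun α _ => ?_
    rw [extF_monomial, map_smul, hcoeff, Algebra.smul_def, mul_comm]

end Pairing

/-! ### Non-vanishing of the pairing at an isolated zero (local duality) -/

section Duality

variable {k : Type*} [Field k] {F : Type*} [Field F] [Algebra k F] {m : ℕ}

local notation3 "extF[" ψ "]" => (MvPolynomial.basisMonomials (Fin m) F).constr F
    (fun α : Fin m →₀ ℕ => algebraMap k F ((ψ : MvPolynomial (Fin m) k →ₗ[k] k) (monomial α 1)))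

local notation3 "θ[" P "]" => (MvPolynomial.aeval
    (Sum.elim (fun i : Fin m => (X i : MvPolynomial (Fin m) F)) fun j : Fin m => C ((P : Fin m → F) j)) :
      MvPolynomial (Fin m ⊕ Fin m) k →ₐ[k] MvPolynomial (Fin m) F)

/-- `τ_P`: the translation `xᵢ ↦ xᵢ + Pᵢ` of `F[x]`, moving the point `P` to the origin. Local
notation only. -/
local notation3 "τ[" P "]" => (MvPolynomial.aeval
    (fun i : Fin m => (X i : MvPolynomial (Fin m) F) + C ((P : Fin m → F) i)) :
      MvPolynomial (Fin m) F →ₐ[F] MvPolynomial (Fin m) F)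

/-- The constant coefficient after translating by `P` is the value at `P`. [folklore] -/
theorem constantCoeff_tau (P : Fin m → F) (Q : MvPolynomial (Fin m) F) :
    constantCoeff (τ[P] Q) = eval P Q := by
  induction Q using MvPolynomial.induction_on with
  | C a => rw [algHom_C, MvPolynomial.algebraMap_eq, constantCoeff_C, eval_C]
  | add p q hp hq => rw [map_add, map_add, hp, hq, map_add]
  | mul_X p i hp =>
    rw [map_mul, map_mul, hp, aeval_X, map_add, constantCoeff_X, constantCoeff_C, zero_add, map_mul,
      eval_X]

/-- **Coefficient extraction over a basis of `F/k`**: if `extF[ψ](D) = 0` for every functional `ψ`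
vanishing on the ideal `J ⊆ k[x]`, then `D ∈ J · F[x]`. (Expand the coefficients of `D` in a
`k`-basis of `F`: `D = ∑ₜ bₜ Dₜ` with `Dₜ ∈ k[x]`, and `extF[ψ](D) = ∑ₜ ψ(Dₜ) bₜ`.) [folklore] -/
theorem mem_map_of_forall_dual (J : Ideal (MvPolynomial (Fin m) k)) (D : MvPolynomial (Fin m) F)
    (hD : ∀ ψ : MvPolynomial (Fin m) k →ₗ[k] k, (∀ r ∈ J, ψ r = 0) → extF[ψ] D = 0) :
    D ∈ J.map (MvPolynomial.map (algebraMap k F)) := by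
  classical
  let b := Module.Basis.ofVectorSpace k F
  let Dt : Module.Basis.ofVectorSpaceIndex k F → MvPolynomial (Fin m) k := fun t =>
    ∑ α ∈ D.support, monomial α (b.coord t (coeff α D))
  have hcoeffDt : ∀ t α, coeff α (Dt t) = b.coord t (coeff α D) := by
    intro t α
    simp only [Dt, coeff_sum, coeff_monomial, Finset.sum_ite_eq', mem_support_iff, ne_eq, ite_not]
    split_ifs with h
    · rw [h, map_zero]
    · rfl
  let T0 : Finset (Module.Basis.ofVectorSpaceIndex k F) :=
    D.support.biUnion fun α => (b.repr (coeff α D)).support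
  have hdecomp : D = ∑ t ∈ T0, b t • map (algebraMap k F) (Dt t) := by
    ext α
    rw [coeff_sum]
    simp only [coeff_smul, coeff_map, hcoeffDt]
    have hterm : ∀ t, b t • algebraMap k F (b.coord t (coeff α D)) = (b.repr (coeff α D) t) • b t := by
      intro t
      rw [smul_eq_mul, Algebra.smul_def, mul_comm, Module.Basis.coord_apply]
    simp only [hterm]
    by_cases hα : α ∈ D.support
    · have hsupp : (b.repr (coeff α D)).support ⊆ T0 :=
        Finset.subset_biUnion_of_mem (fun α => (b.repr (coeff α D)).support) hα
      conv_lhs => rw [← b.linearCombination_repr (coeff α D), Finsupp.linearCombination_apply,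
        Finsupp.sum]
      exact Finset.sum_subset hsupp fun t _ ht => by rw [Finsupp.notMem_support_iff.mp ht, zero_smul]
    · rw [notMem_support_iff.mp hα]
      simp
  have hDt : ∀ t ∈ T0, Dt t ∈ J := by
    intro t ht
    by_contra hnot
    have hnot' : Dt t ∉ J.restrictScalars k := hnot
    obtain ⟨ψ, hψ1, hψ2⟩ := Submodule.exists_dual_map_eq_bot_of_notMem hnot' inferInstance
    have hψ : ∀ r ∈ J, ψ r = 0 := fun r hr => by
      have : ψ r ∈ (J.restrictScalars k).map ψ := Submodule.mem_map_of_mem hr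
      rwa [hψ2, Submodule.mem_bot] at this
    have h0 := hD ψ hψ
    rw [hdecomp, map_sum] at h0
    simp only [map_smul, extF_map] at h0
    have h0' : ∑ t ∈ T0, (ψ (Dt t)) • b t = 0 := by
      rw [← h0]
      exact Finset.sum_congr rfl fun t _ => by rw [smul_eq_mul, Algebra.smul_def, mul_comm]
    exact hψ1 (linearIndependent_iff'.mp b.linearIndependent T0 (fun t => ψ (Dt t)) h0' t ht)
  rw [hdecomp]
  refine Ideal.sum_mem _ fun t ht => ?_
  rw [smul_eq_C_mul]
  exact Ideal.mul_mem_left _ _ (Ideal.mem_map_of_mem _ (hDt t ht))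

/-- The minimal polynomial of an algebraic element `a` of an extension `F` of a perfect field `k`
factors over `F` as `(t − a) ρ(t)` with `ρ(a) ≠ 0` (separability). [folklore] -/
theorem exists_minpoly_map_eq_mul [PerfectField k] {a : F} (ha : IsIntegral k a) :
    ∃ ρ : Polynomial F, (Polynomial.X - Polynomial.C a) * ρ = (minpoly k a).map (algebraMap k F) ∧
      ρ.eval a ≠ 0 := by
  set μ := (minpoly k a).map (algebraMap k F) with hμ
  have hroot : μ.IsRoot a := by
    rw [Polynomial.IsRoot.def, hμ, Polynomial.eval_map_algebraMap, minpoly.aeval]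
  refine ⟨μ /ₘ (Polynomial.X - Polynomial.C a), (Polynomial.mul_divByMonic_eq_iff_isRoot).mpr hroot, ?_⟩
  have hsep : (minpoly k a).Separable := PerfectField.separable_of_irreducible (minpoly.irreducible ha)
  have hder : Polynomial.aeval a (Polynomial.derivative (minpoly k a)) ≠ 0 :=
    hsep.aeval_derivative_ne_zero (minpoly.aeval k a)
  intro h0
  apply hder
  have e1 : Polynomial.derivative μ = μ /ₘ (Polynomial.X - Polynomial.C a) +
      (Polynomial.X - Polynomial.C a) * Polynomial.derivative (μ /ₘ (Polynomial.X - Polynomial.C a)) := by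
    conv_lhs => rw [← (Polynomial.mul_divByMonic_eq_iff_isRoot).mpr hroot]
    rw [Polynomial.derivative_mul, Polynomial.derivative_sub, Polynomial.derivative_X,
      Polynomial.derivative_C, sub_zero, one_mul]
  have e2 : Polynomial.eval a (Polynomial.derivative μ) = 0 := by
    rw [e1, Polynomial.eval_add, Polynomial.eval_mul, Polynomial.eval_sub, Polynomial.eval_X,
      Polynomial.eval_C, sub_self, zero_mul, add_zero, h0]
  rwa [hμ, Polynomial.derivative_map, Polynomial.eval_map_algebraMap] at e2

variable {H : Fin m → MvPolynomial (Fin m) k} {P : Fin m → F}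

/-- **Non-vanishing of the pairing at an isolated zero** (local duality for the local complete
intersection at `P`). Let `Hᵢ(x) − Hᵢ(y) = ∑ⱼ (xⱼ − yⱼ) pᵢⱼ(x, y)` (a Bezoutian matrix), `P` a common
zero of the `Hᵢ` with algebraic coordinates, and suppose `(H)` is isolated at the closed point of
`P` in the sense that `u · ∏… ∈ (H)`: `u μᵢ(xᵢ)ᴺ ∈ (H)` for all `i` with `u(P) ≠ 0`, `μᵢ` the minimal
polynomial of `Pᵢ`. Then some functional `ψ ⊥ (H)` has `(ψ ⊗ ev_P)(det p) ≠ 0`. (Otherwise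
`Δ(x, P) ∈ (H) F[x]` by `mem_map_of_forall_dual`; translating `P` to the origin, `Δ(x, P)` becomes
the transition determinant of Wiebe's lemma `det_notMem_span_of_mem`, a contradiction.)
[cite: DeSmitRubinSchoof1997, Prop. 2.1 and Cor. 2.2] -/
theorem exists_dual_extF_theta_det_ne_zero [CharZero k] (hint : ∀ i, IsIntegral k (P i))
    (hP : ∀ i, aeval P (H i) = 0)
    (hiso : ∃ u : MvPolynomial (Fin m) k, aeval P u ≠ 0 ∧ ∃ N : ℕ, ∀ i,
      u * (Polynomial.aeval (X i : MvPolynomial (Fin m) k) (minpoly k (P i))) ^ N ∈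
        Ideal.span (Set.range H))
    (p : Matrix (Fin m) (Fin m) (MvPolynomial (Fin m ⊕ Fin m) k))
    (hp : ∀ i, rename Sum.inl (H i) - rename Sum.inr (H i) =
      ∑ j, (X (Sum.inl j) - X (Sum.inr j)) * p i j) :
    ∃ ψ : MvPolynomial (Fin m) k →ₗ[k] k, (∀ r ∈ Ideal.span (Set.range H), ψ r = 0) ∧
      extF[ψ] (θ[P] p.det) ≠ 0 := by
  classical
  by_contra hcon
  push Not at hcon
  set J : Ideal (MvPolynomial (Fin m) k) := Ideal.span (Set.range H) with hJ
  have hDJ : θ[P] p.det ∈ J.map (MvPolynomial.map (algebraMap k F)) :=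
    mem_map_of_forall_dual J _ fun ψ hψ => hcon ψ hψ
  -- translate `P` to the origin
  set h' : Fin m → MvPolynomial (Fin m) F := fun i => τ[P] (map (algebraMap k F) (H i)) with hh'
  set a : Matrix (Fin m) (Fin m) (MvPolynomial (Fin m) F) :=
    Matrix.of fun i j => τ[P] (θ[P] (p i j)) with ha
  have hJ' : (J.map (MvPolynomial.map (algebraMap k F))).map (τ[P] : MvPolynomial (Fin m) F →+*
      MvPolynomial (Fin m) F) = Ideal.span (Set.range h') := by
    rw [hJ, Ideal.map_span, Ideal.map_span, ← Set.range_comp, ← Set.range_comp]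
    rfl
  -- (a) `h' i = ∑ a i j * x j`
  have hha : ∀ i, h' i = ∑ j, a i j * X j := by
    intro i
    have h1 := congrArg (θ[P]) (hp i)
    rw [map_sub, theta_rename_inl, theta_rename_inr, hP i, C_0, sub_zero, map_sum] at h1
    have h2 := congrArg (τ[P]) h1
    rw [map_sum] at h2
    simp only [hh', h2, ha, Matrix.of_apply]
    refine Finset.sum_congr rfl fun j _ => ?_
    rw [map_mul, map_sub, aeval_X, aeval_X, Sum.elim_inl, Sum.elim_inr, map_mul, map_sub, aeval_X,
      algHom_C, MvPolynomial.algebraMap_eq, add_sub_cancel_right, mul_comm]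
  -- (b) `det a = τ θ (det p)`
  have hdet : a.det = τ[P] (θ[P] p.det) := by
    have e : a = ((τ[P] : MvPolynomial (Fin m) F →+* MvPolynomial (Fin m) F).comp
        (θ[P] : MvPolynomial (Fin m ⊕ Fin m) k →+* MvPolynomial (Fin m) F)).mapMatrix p := by
      ext i j; rfl
    rw [e, ← RingHom.map_det]
    rfl
  -- (c) `τ θ (det p) ∈ (h')`
  have hmem : τ[P] (θ[P] p.det) ∈ Ideal.span (Set.range h') := by
    rw [← hJ']; exact Ideal.mem_map_of_mem _ hDJ
  -- (d) the hypotheses of Wiebe's lemma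
  obtain ⟨u, hu, N, hN⟩ := hiso
  choose ρ hρμ hρ0 using fun i => exists_minpoly_map_eq_mul (k := k) (hint i)
  set ρt : Fin m → MvPolynomial (Fin m) F := fun i =>
    Polynomial.aeval ((X i : MvPolynomial (Fin m) F) + C (P i)) (ρ i) with hρt
  have hkey : ∀ i, τ[P] (map (algebraMap k F)
      (Polynomial.aeval (X i : MvPolynomial (Fin m) k) (minpoly k (P i)))) = X i * ρt i := by
    intro i
    have e1 : map (algebraMap k F) (Polynomial.aeval (X i : MvPolynomial (Fin m) k) (minpoly k (P i))) =
        Polynomial.aeval (X i : MvPolynomial (Fin m) F) ((minpoly k (P i)).map (algebraMap k F)) := by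
      rw [Polynomial.aeval_map_algebraMap]
      have := Polynomial.aeval_algHom_apply (MvPolynomial.mapAlgHom (σ := Fin m) (Algebra.ofId k F))
        (X i : MvPolynomial (Fin m) k) (minpoly k (P i))
      rw [mapAlgHom_apply, mapAlgHom_apply, map_X] at this
      exact this.symm
    rw [e1, ← hρμ i, map_mul, map_sub, Polynomial.aeval_X, Polynomial.aeval_C,
      MvPolynomial.algebraMap_eq, map_mul, map_sub, aeval_X, algHom_C, MvPolynomial.algebraMap_eq,
      add_sub_cancel_right, ← Polynomial.aeval_algHom_apply, aeval_X]
  set ut : MvPolynomial (Fin m) F := τ[P] (map (algebraMap k F) u) * ∏ i, ρt i ^ (N + 1) with hut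
  have hb : ∀ i, ut * X i ^ (N + 1) ∈ Ideal.span (Set.range h') := by
    intro i
    have h1 : u * (Polynomial.aeval (X i : MvPolynomial (Fin m) k) (minpoly k (P i))) ^ (N + 1) ∈ J := by
      rw [pow_succ, ← mul_assoc]; exact Ideal.mul_mem_right _ _ (hN i)
    have h2 : τ[P] (map (algebraMap k F)
        (u * (Polynomial.aeval (X i : MvPolynomial (Fin m) k) (minpoly k (P i))) ^ (N + 1))) ∈
        Ideal.span (Set.range h') := by
      rw [← hJ']; exact Ideal.mem_map_of_mem _ (Ideal.mem_map_of_mem _ h1)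
    rw [map_mul, map_pow, map_mul, map_pow, hkey i, mul_pow] at h2
    have e : ut * X i ^ (N + 1) = τ[P] (map (algebraMap k F) u) * (X i ^ (N + 1) * ρt i ^ (N + 1)) *
        ∏ i' ∈ Finset.univ.erase i, ρt i' ^ (N + 1) := by
      rw [hut, ← Finset.mul_prod_erase Finset.univ (fun i' => ρt i' ^ (N + 1)) (Finset.mem_univ i)]
      ring
    rw [e]
    exact Ideal.mul_mem_right _ _ h2
  have hu0 : coeff 0 ut ≠ 0 := by
    rw [← constantCoeff_eq, hut, map_mul, map_prod, constantCoeff_tau, eval_map, ← aeval_def]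
    refine mul_ne_zero hu (Finset.prod_ne_zero_iff.mpr fun i _ => ?_)
    rw [map_pow]
    refine pow_ne_zero _ ?_
    have e : ρt i = τ[P] (Polynomial.aeval (X i : MvPolynomial (Fin m) F) (ρ i)) := by
      rw [hρt, ← Polynomial.aeval_algHom_apply, aeval_X]
    rw [e, constantCoeff_tau]
    have e2 : eval P (Polynomial.aeval (X i : MvPolynomial (Fin m) F) (ρ i)) = (ρ i).eval (P i) := by
      have := Polynomial.aeval_algHom_apply (MvPolynomial.aeval P : MvPolynomial (Fin m) F →ₐ[F] F)
        (X i : MvPolynomial (Fin m) F) (ρ i)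
      rw [aeval_X, Polynomial.coe_aeval_eq_eval] at this
      rw [← MvPolynomial.aeval_eq_eval, ← this]
    rw [e2]
    exact hρ0 i
  -- (e) Wiebe's lemma
  exact det_notMem_span_of_mem a h' ut (Nat.succ_le_succ (Nat.zero_le N)) hha hb hu0 (hdet ▸ hmem)

/-! ### Interpolation at an isolated zero -/

/-- **Interpolation at an isolated zero.** Let `k ⊆ F` be fields of characteristic `0`,
`H₁, …, H_m ∈ k[x₁, …, x_m]` of degrees `≤ e₁, …, e_m` (`eᵢ ≥ 1`), and `P ∈ Fᵐ` a common zero with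
algebraic coordinates at which `(H)` is ISOLATED: `u μᵢ(xᵢ)ᴺ ∈ (H)` for all `i`, for some `u` with
`u(P) ≠ 0` and `μᵢ` the minimal polynomial of `Pᵢ` over `k` (this holds when the closed point of `P`
is an isolated point of `V(H)`, the `μᵢ(xᵢ)` lying in its maximal ideal). Then for every
`ν ≥ e₁ + ⋯ + e_m − m` the polynomials of degree `≤ ν` ALREADY map onto `k[P] = k(P)` under
evaluation at `P`: "an isolated zero imposes independent conditions on polynomials of degree
`e₁ + ⋯ + e_m − m`" (Jacobi–Kronecker interpolation by the Bezoutian `Δ(x, y) = det(pᵢⱼ)`,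
`Hᵢ(x) − Hᵢ(y) = ∑ (xⱼ − yⱼ) pᵢⱼ`, for simple zeros; Scheja–Storch / Tate–Wiebe local duality for
multiple isolated zeros). Proof: the values `(ψ ⊗ ev_P)(Δ)` for `ψ ⊥ (H)` are values at `P` of
polynomials of degree `≤ deg Δ ≤ ∑ (eᵢ − 1)`, form a `k[P]`-submodule of `F` (`Pⱼ` acts as
`ψ ↦ ψ(xⱼ ·)` by Cramer's rule), and do not all vanish (`exists_dual_extF_theta_det_ne_zero`);
`k[P]` being a field, they exhaust it. [cite: DeSmitRubinSchoof1997, Prop. 2.1 and Cor. 2.2] -/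
theorem exists_totalDegree_le_aeval_eq_of_isolated [CharZero k]
    (H : Fin m → MvPolynomial (Fin m) k) (e : Fin m → ℕ) (he : ∀ i, 1 ≤ e i)
    (hdeg : ∀ i, (H i).totalDegree ≤ e i) (P : Fin m → F) (hint : ∀ i, IsIntegral k (P i))
    (hP : ∀ i, aeval P (H i) = 0)
    (hiso : ∃ u : MvPolynomial (Fin m) k, aeval P u ≠ 0 ∧ ∃ N : ℕ, ∀ i,
      u * (Polynomial.aeval (X i : MvPolynomial (Fin m) k) (minpoly k (P i))) ^ N ∈
        Ideal.span (Set.range H))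
    {ν : ℕ} (hν : ∑ i, e i ≤ ν + m) {z : F} (hz : z ∈ Algebra.adjoin k (Set.range P)) :
    ∃ f : MvPolynomial (Fin m) k, f.totalDegree ≤ ν ∧ aeval P f = z := by
  classical
  obtain ⟨p, hp, hpdeg, hcramer⟩ := exists_bezoutian H e he hdeg
  set J : Ideal (MvPolynomial (Fin m) k) := Ideal.span (Set.range H) with hJ
  -- the values of the pairing and their span `T`
  set S : Set F := {w | ∃ ψ : MvPolynomial (Fin m) k →ₗ[k] k, (∀ r ∈ J, ψ r = 0) ∧
    w = extF[ψ] (θ[P] p.det)} with hS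
  set T : Submodule k F := Submodule.span k S with hT
  -- (1) `T` consists of values of polynomials of degree `≤ ν`
  have hT1 : ∀ w ∈ T, ∃ f : MvPolynomial (Fin m) k, f.totalDegree ≤ ν ∧ aeval P f = w := by
    intro w hw
    induction hw using Submodule.span_induction with
    | mem w hw =>
      obtain ⟨ψ, -, rfl⟩ := hw
      obtain ⟨f, hf, hfw⟩ := exists_totalDegree_le_aeval_eq_extF_theta (P := P) ψ p.det
      exact ⟨f, hf.trans (by omega), hfw⟩
    | zero => exact ⟨0, by simp, by simp⟩
    | add w w' _ _ hw hw' =>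
      obtain ⟨f, hf, rfl⟩ := hw
      obtain ⟨f', hf', rfl⟩ := hw'
      exact ⟨f + f', (totalDegree_add f f').trans (max_le hf hf'), by rw [map_add]⟩
    | smul c w _ hw =>
      obtain ⟨f, hf, rfl⟩ := hw
      exact ⟨c • f, (totalDegree_smul_le c f).trans hf, by rw [map_smul]⟩
  -- (2) `T` is stable under multiplication by the `P j`
  have hT2 : ∀ j, ∀ w ∈ T, P j * w ∈ T := by
    intro j w hw
    induction hw using Submodule.span_induction with
    | mem w hw =>
      obtain ⟨ψ, hψ, rfl⟩ := hw
      rw [mul_extF_theta_eq ψ hψ hP (hcramer j)]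
      refine Submodule.subset_span ⟨_, fun r hr => ?_, rfl⟩
      rw [LinearMap.comp_apply, LinearMap.mul_apply']
      exact hψ _ (Ideal.mul_mem_left _ _ hr)
    | zero => rw [mul_zero]; exact Submodule.zero_mem _
    | add w w' _ _ hw hw' => rw [mul_add]; exact Submodule.add_mem _ hw hw'
    | smul c w _ hw => rw [mul_smul_comm]; exact Submodule.smul_mem _ c hw
  -- (3) hence under multiplication by `k[P]`
  have hT3 : ∀ r ∈ Algebra.adjoin k (Set.range P), ∀ w ∈ T, r * w ∈ T := by
    intro r hr
    induction hr using Algebra.adjoin_induction with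
    | mem r hr => obtain ⟨j, rfl⟩ := hr; exact hT2 j
    | algebraMap c => intro w hw; rw [← Algebra.smul_def]; exact Submodule.smul_mem _ c hw
    | add r s _ _ hr hs => intro w hw; rw [add_mul]; exact Submodule.add_mem _ (hr w hw) (hs w hw)
    | mul r s _ _ hr hs => intro w hw; rw [mul_assoc]; exact hr _ (hs w hw)
  -- (4) a non-zero value
  obtain ⟨ψ₀, hψ₀, hne⟩ := exists_dual_extF_theta_det_ne_zero hint hP hiso p hp
  set w₀ := extF[ψ₀] (θ[P] p.det) with hw₀
  have hw₀T : w₀ ∈ T := Submodule.subset_span ⟨ψ₀, hψ₀, rfl⟩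
  -- (5) which lies in the field `k[P]`
  have hw₀A : w₀ ∈ Algebra.adjoin k (Set.range P) := by
    obtain ⟨f, -, hf⟩ := hT1 w₀ hw₀T
    rw [Algebra.adjoin_range_eq_range_aeval, ← hf]
    exact ⟨f, rfl⟩
  have hint' : IsIntegral k w₀ := by
    refine IsIntegral.of_mem_of_fg (Algebra.adjoin k (Set.range P)) ?_ w₀ hw₀A
    exact fg_adjoin_of_finite (Set.finite_range P) (by rintro _ ⟨i, rfl⟩; exact hint i)
  have hinv : w₀⁻¹ ∈ Algebra.adjoin k (Set.range P) := hint'.inv_mem hw₀A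
  -- (6) conclusion
  have hzT : z ∈ T := by
    have e1 : z = (z * w₀⁻¹) * w₀ := by rw [mul_assoc, inv_mul_cancel₀ hne, mul_one]
    rw [e1]
    exact hT3 _ (Subalgebra.mul_mem _ hz hinv) w₀ hw₀T
  exact hT1 z hzT

end Duality

end Literature.RingTheory.CompleteIntersection

end
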